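import Literature.Topology.FourManifolds.SurfaceGroupCutKernelMoves
import HarnessLib

/-!
# Automorphisms of the surface group stabilising cut kernels, III: the letter-conjugating
# orientation flip of `S_g` (every genus)

Topic `Literature/Topology/FourManifolds`; theorems only, sequel to `SurfaceGroupCutKernelMoves.lean`.
An explicit ORIENTATION-REVERSING automorphism of the surface group
`S_g = ⟨a₀,b₀,…,a_{g-1},b_{g-1} ∣ ∏[aᵢ,bᵢ]⟩` at every genus, generalising the genus-`3` flip
`exists_flip_freeGroup_three` of `TrisectionFunctorGKStabilization.lean`: with
`Pᵢ₊₁ = ∏_{h>i}[a_h,b_h] = mid i g`,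

  `θ(aᵢ) = Pᵢ₊₁⁻¹ aᵢ⁻¹ Pᵢ₊₁`,  `θ(bᵢ) = Pᵢ₊₁⁻¹ (aᵢbᵢaᵢ⁻¹) Pᵢ₊₁`.

Then `θ[aᵢ,bᵢ] = Pᵢ₊₁⁻¹[aᵢ,bᵢ]⁻¹Pᵢ₊₁ = Pᵢ⁻¹Pᵢ₊₁`, so `θ(∏[aᵢ,bᵢ]) = P₀⁻¹P_g = r⁻¹` telescopes
(`θ` sends the relator to its inverse ON THE NOSE — the algebraic shadow of a reflection of `Σ_g`;
a relator-fixing automorphism cannot reverse orientation), `θ(Pᵢ) = Pᵢ⁻¹` and `θ² = 1`.  Every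
letter goes to a conjugate of itself or of its inverse, so `θ` STABILISES EVERY CUT KERNEL, and
on `H₁` it is `δ_{aᵢ} ↦ -δ_{aᵢ}`, `δ_{bᵢ} ↦ δ_{bᵢ}`, an anti-symplectic involution
(`ν(Θu, Θv) = -ν(u, v)`): `SurfaceGroup.exists_realises_orientationFlip`.  It absorbs the sign
`ε = -1` in the realisation of `±`-symplectic automorphisms by Goeritz groups (Zieschang–Vogt–
Coldewey 3.6.7: the automorphism induced by a homeomorphism is `ε`-symplectic with `ε = -1` iff
it reverses orientation).

* `List.prod_range_telescope` — `∏_{n<N} uₙ⁻¹uₙ₊₁ = u₀⁻¹u_N`;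
* `SurfaceGroup.tailRel_*` — bookkeeping for the tails `Pₙ = ∏_{n ≤ h < g}[a_h,b_h]` of the
  relator (`P₀ = 1` in `S_g`, `P_g = 1`, `Pₙ = [aₙ,bₙ]Pₙ₊₁`, `Pᵢ₊₁ = mid i g`);
* `SurfaceGroup.exists_realises_orientationFlip` — the theorem.

## References

* H. Zieschang, E. Vogt, H.-D. Coldewey, *Surfaces and Planar Discontinuous Groups*, LNM 835
  (1980), §3.6, Thm. 3.6.7 and 3.6.9 (D). [ZieschangVogtColdewey1980]
-/

noncomputable section

namespace Literature.Topology.FourManifolds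

open Multiplicative Subgroup

/-- Telescoping products in a group: `∏_{n<N} uₙ⁻¹ uₙ₊₁ = u₀⁻¹ u_N`. [folklore] -/
theorem List.prod_range_telescope {G : Type*} [Group G] (u : ℕ → G) (N : ℕ) :
    ((List.range N).map fun n => (u n)⁻¹ * u (n + 1)).prod = (u 0)⁻¹ * u N := by
  induction N with
  | zero => simp
  | succ N ih =>
    rw [List.range_succ, List.map_append, List.prod_append, ih, List.map_singleton,
      List.prod_singleton, mul_assoc, mul_inv_cancel_left]

namespace SurfaceGroup

variable {g : ℕ}

/-! ## The tails of the relator -/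

/-- `P₀ = ∏_{h<g}[a_h,b_h] = 1` in `S_g` (the defining relation). [folklore] -/
theorem tailRel_zero :
    ((List.range' 0 (g - 0)).map
      (relFactor fun p => (PresentedGroup.of p : SurfaceGroup g))).prod = 1 := by
  rw [Nat.sub_zero, ← List.range_eq_range']
  exact prod_relFactor_of

/-- `Pₙ = 1` for `n ≥ g` (empty tail). [folklore] -/
theorem tailRel_of_le {n : ℕ} (hn : g ≤ n) :
    ((List.range' n (g - n)).map
      (relFactor fun p => (PresentedGroup.of p : SurfaceGroup g))).prod = 1 := by
  rw [Nat.sub_eq_zero_of_le hn, List.range'_zero, List.map_nil, List.prod_nil]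

/-- `Pₙ = [aₙ,bₙ] Pₙ₊₁` for `n < g`. [folklore] -/
theorem tailRel_of_lt {n : ℕ} (hn : n < g) :
    ((List.range' n (g - n)).map
      (relFactor fun p => (PresentedGroup.of p : SurfaceGroup g))).prod =
      relFactor (fun p => (PresentedGroup.of p : SurfaceGroup g)) n *
        ((List.range' (n + 1) (g - (n + 1))).map
          (relFactor fun p => (PresentedGroup.of p : SurfaceGroup g))).prod := by
  obtain ⟨d, hd⟩ : ∃ d, g - n = d + 1 := ⟨g - n - 1, by omega⟩
  rw [hd, List.range'_succ, List.map_cons, List.prod_cons, show g - (n + 1) = d by omega]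

/-- `Pᵢ₊₁ = mid i g` (the middle block between handle `i` and the end). [folklore] -/
theorem mid_eq_tailRel (i : ℕ) :
    (mid i g : SurfaceGroup g) =
      ((List.range' (i + 1) (g - (i + 1))).map
        (relFactor fun p => (PresentedGroup.of p : SurfaceGroup g))).prod :=
  rfl

/-- `[aᵢ,bᵢ]` as the `i`-th relator factor. [folklore] -/
theorem relFactor_of_fin (i : Fin g) :
    relFactor (fun p => (PresentedGroup.of p : SurfaceGroup g)) i = a i * b i * (a i)⁻¹ * (b i)⁻¹ := by
  rw [relFactor_fin]
  rfl

/-! ## The orientation flip -/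

/-- **The letter-conjugating orientation flip of `S_g`.**  There is an automorphism `x` of the
genus-`g` surface group with `x(aᵢ) = Pᵢ₊₁⁻¹aᵢ⁻¹Pᵢ₊₁`, `x(bᵢ) = Pᵢ₊₁⁻¹aᵢbᵢaᵢ⁻¹Pᵢ₊₁`
(`Pᵢ₊₁ = ∏_{h>i}[a_h,b_h]`; it sends the relator to its inverse and is an involution), which
stabilises EVERY cut kernel (each letter goes to a conjugate of its inverse or of itself) and
acts on `H₁` by the anti-symplectic involution `Θ : δ_{aᵢ} ↦ -δ_{aᵢ}, δ_{bᵢ} ↦ δ_{bᵢ}`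
(`(Θ v)_{(i,s)} = ± v_{(i,s)}`, sign `-` on the `a`-letters). [folklore] -/
theorem exists_realises_orientationFlip (g : ℕ) :
    ∃ (x : SurfaceGroup g ≃* SurfaceGroup g) (Θ : (surfaceGen g → ℤ) ≃ₗ[ℤ] (surfaceGen g → ℤ)),
      (∀ v p, Θ v p = (if p.2 then 1 else -1) * v p) ∧
      (∀ c : Fin g → Bool, (cutKernel c).map x.toMonoidHom = cutKernel c) ∧
      ∀ s, toAdd (SurfaceGroup.abelianize g (x s)) = Θ (toAdd (SurfaceGroup.abelianize g s)) := by
  obtain ⟨Θ, hΘ, hΘs⟩ := exists_signedPerm (Equiv.refl (surfaceGen g))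
    (fun p => if p.2 then 1 else -1) (fun p => by cases p.2 <;> simp)
  -- the tails of the relator and the generator images
  let F : ℕ → SurfaceGroup g := relFactor fun p => (PresentedGroup.of p : SurfaceGroup g)
  let P : ℕ → SurfaceGroup g := fun n => ((List.range' n (g - n)).map F).prod
  let f : surfaceGen g → SurfaceGroup g := fun p =>
    if p.2 then (P (p.1 + 1))⁻¹ * (a p.1 * b p.1 * (a p.1)⁻¹) * P (p.1 + 1)
    else (P (p.1 + 1))⁻¹ * (a p.1)⁻¹ * P (p.1 + 1)
  have hPg : ∀ n, g ≤ n → P n = 1 := fun n hn => tailRel_of_le hn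
  have hPlt : ∀ n, n < g → P n = F n * P (n + 1) := fun n hn => tailRel_of_lt hn
  have hP0 : P 0 = 1 := tailRel_zero
  -- the relator factors of the images telescope: `[f aₙ, f bₙ] = Pₙ⁻¹ Pₙ₊₁`
  have hrel : ∀ n, relFactor f n = (P n)⁻¹ * P (n + 1) := by
    intro n
    by_cases hn : n < g
    · rw [hPlt n hn, relFactor]
      rw [dif_pos hn]
      have hF : F n = a ⟨n, hn⟩ * b ⟨n, hn⟩ * (a ⟨n, hn⟩)⁻¹ * (b ⟨n, hn⟩)⁻¹ := relFactor_of_fin ⟨n, hn⟩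
      rw [hF]
      simp only [f, if_true, Bool.false_eq_true, if_false]
      group
    · rw [not_lt] at hn
      rw [hPg n hn, hPg (n + 1) (by omega), relFactor, dif_neg (not_lt.2 hn), inv_one, mul_one]
  have hf : ((List.range g).map (relFactor f)).prod = 1 := by
    rw [show (List.range g).map (relFactor f) = (List.range g).map fun n => (P n)⁻¹ * P (n + 1) from
      List.map_congr_left fun n _ => hrel n, List.prod_range_telescope, hP0, hPg g le_rfl, inv_one,
      mul_one]
  -- `θ = homOfGens f` inverts the tails: `θ(Pₙ) = Pₙ⁻¹`
  have hθP : ∀ d n, g = n + d → homOfGens f hf (P n) = (P n)⁻¹ := by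
    intro d
    induction d with
    | zero =>
      intro n hn
      rw [hPg n (by omega), map_one, inv_one]
    | succ d ih =>
      intro n hn
      have hn' : n < g := by omega
      have hFn : homOfGens f hf (F n) = relFactor f n := by
        simp only [F]
        rw [map_relFactor]
        congr 1
        funext p
        exact homOfGens_of f hf p
      rw [hPlt n hn', map_mul, ih (n + 1) (by omega), hFn, hrel n, hPlt n hn']
      group
  have hθP' : ∀ n, homOfGens f hf (P n) = (P n)⁻¹ := fun n => by
    by_cases hn : n ≤ g
    · exact hθP (g - n) n (by omega)
    · rw [hPg n (by omega), map_one, inv_one]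
  -- `θ` is an involution on the letters
  have hinv : ∀ p, homOfGens f hf (f p) = PresentedGroup.of p := by
    rintro ⟨i, _ | _⟩
    · simp only [f, Bool.false_eq_true, if_false, map_mul, map_inv, hθP', homOfGens_a]
      rw [← a_def]
      group
    · simp only [f, if_true, map_mul, map_inv, hθP', homOfGens_a, homOfGens_b]
      simp only [Bool.false_eq_true, if_false]
      rw [← b_def]
      group
  let x : SurfaceGroup g ≃* SurfaceGroup g := equivOfGens f f hf hf hinv hinv
  have hxa : ∀ i : Fin g, x (a i) = (P (i + 1))⁻¹ * (a i)⁻¹ * P (i + 1) := fun i => by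
    simp [x, a_def i, f]
  have hxb : ∀ i : Fin g, x (b i) = (P (i + 1))⁻¹ * (a i * b i * (a i)⁻¹) * P (i + 1) := fun i => by
    simp [x, b_def i, f]
  have hxa' : ∀ i : Fin g, x.symm (a i) = (P (i + 1))⁻¹ * (a i)⁻¹ * P (i + 1) := fun i => by
    simp [x, a_def i, f]
  have hxb' : ∀ i : Fin g, x.symm (b i) = (P (i + 1))⁻¹ * (a i * b i * (a i)⁻¹) * P (i + 1) := fun i => by
    simp [x, b_def i, f]
  refine ⟨x, Θ, fun v p => by rw [hΘ]; rfl, fun c => ?_, ?_⟩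
  · refine map_cutKernel_eq_of x c c (fun i => ?_) (fun i => ?_)
    · cases hc : c i
      · rw [← a_def, hxa]
        simp only [map_mul, map_inv, erase_a_of_eq_false c hc]
        group
      · rw [← b_def, hxb]
        simp only [map_mul, map_inv, erase_b_of_eq_true c hc]
        group
    · cases hc : c i
      · rw [← a_def, hxa']
        simp only [map_mul, map_inv, erase_a_of_eq_false c hc]
        group
      · rw [← b_def, hxb']
        simp only [map_mul, map_inv, erase_b_of_eq_true c hc]
        group
  · refine abelianize_comp_eq_of_apply_of x Θ ?_
    rintro ⟨i, _ | _⟩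
    · rw [← a_def, hxa, hΘs, Equiv.refl_symm, Equiv.refl_apply]
      simp only [map_mul, map_inv, toAdd_mul, toAdd_inv, abelianize_a, toAdd_ofAdd, Bool.false_eq_true,
        if_false]
      rw [neg_one_mul, Pi.single_neg]
      abel
    · rw [← b_def, hxb, hΘs, Equiv.refl_symm, Equiv.refl_apply]
      simp only [map_mul, map_inv, toAdd_mul, toAdd_inv, abelianize_a, abelianize_b, toAdd_ofAdd,
        if_true, one_mul]
      abel

/-- The homology action of the orientation flip is anti-symplectic: if `(Θ v)_{(i,s)} = ± v_{(i,s)}`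
with sign `-` exactly on the `a`-letters then `ν(Θ u, Θ v) = -ν(u, v)`. [folklore] -/
theorem symplForm_orientationFlip (Θ : (surfaceGen g → ℤ) ≃ₗ[ℤ] (surfaceGen g → ℤ))
    (hΘ : ∀ v p, Θ v p = (if p.2 then 1 else -1) * v p) (u v : surfaceGen g → ℤ) :
    symplForm (Θ u) (Θ v) = -symplForm u v := by
  rw [symplForm_apply, symplForm_apply, ← Finset.sum_neg_distrib]
  refine Finset.sum_congr rfl fun i _ => ?_
  simp only [hΘ, if_true, Bool.false_eq_true, if_false]
  ring

end SurfaceGroup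

end Literature.Topology.FourManifolds

end
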